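import Summits.Ventures.CertifiedArithmetic.LowPrec.Directed

/-!
# Monotonicity of the roundings (Theorem E3, every format)

HONEST FRAMING (venture CertifiedArithmetic / cell `pub-lowprec`): certified error envelopes and
provably optimal rounding/accumulation schemes for low-precision formats under stated cost models;
every table by two implementations; no hardware or vendor claims.

`roundNE φ` is monotone as a map `ℚ → values` (`toRat_roundNE_mono`) — derived from the NEAREST
property alone (any nearest rounding is monotone on pairs `x < y`; ties are irrelevant there), so
it holds for every format, including under saturation. The directed roundings are monotone in
range by their optimality characterisations (`toRat_roundDown_mono`, `toRat_roundUp_mono`). These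
are the structural reasons the cell's exhaustive tables report `0` monotonicity violations
(THEOREMS-R1 §3, E3); commutativity of `fmul`/`fadd` is definitional (`ℚ` is commutative).
-/

namespace Literature.ComputerArithmetic.FloatingPoint

namespace MiniFloat

open Format

variable {φ : Format}

/-- ANY nearest-value selection is monotone: if `fx`, `fy` are values nearest to `x`, `y` among
the finite data and `x < y`, then `fx ≤ fy`. [folklore] -/
theorem nearest_mono {x y : ℚ} (hxy : x < y) (fx fy : MiniFloat φ)
    (hx : ∀ z : MiniFloat φ, |x - fx.toRat| ≤ |x - z.toRat|)
    (hy : ∀ z : MiniFloat φ, |y - fy.toRat| ≤ |y - z.toRat|) : fx.toRat ≤ fy.toRat := by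
  by_contra hlt
  have hlt : fy.toRat < fx.toRat := not_le.mp hlt
  have h1 := hx fy
  have h2 := hy fx
  -- case analysis on the position of x relative to fy and of y relative to fx
  rcases le_or_gt (fy.toRat) x with hfyx | hfyx
  · -- fy ≤ x
    rcases le_or_gt y (fx.toRat) with hyfx | hyfx
    · -- fy ≤ x < y ≤ fx
      rw [abs_of_nonpos (by linarith : x - fx.toRat ≤ 0), abs_of_nonneg (by linarith)] at h1
      rw [abs_of_nonneg (by linarith : 0 ≤ y - fy.toRat), abs_of_nonpos (by linarith)] at h2
      linarith
    · -- fy < fx < y: fx is strictly closer to y than fy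
      rw [abs_of_nonneg (by linarith : 0 ≤ y - fy.toRat), abs_of_nonneg (by linarith)] at h2
      linarith
  · -- x < fy < fx: fy is strictly closer to x than fx
    rw [abs_of_nonpos (by linarith : x - fx.toRat ≤ 0), abs_of_nonpos (by linarith)] at h1
    linarith

/-- E3: ROUND-TO-NEAREST-EVEN IS MONOTONE (as a map to values, every format, saturation
included). [folklore] -/
theorem toRat_roundNE_mono {x y : ℚ} (hxy : x ≤ y) : (roundNE φ x).toRat ≤ (roundNE φ y).toRat := by
  rcases eq_or_lt_of_le hxy with h | h
  · rw [h]
  · exact nearest_mono h _ _ (roundNE_nearest x) (roundNE_nearest y)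

/-- E3: round-down is monotone in range. [folklore] -/
theorem toRat_roundDown_mono {x y : ℚ} (hxy : x ≤ y) (hx : |x| ≤ φ.maxRat) (hy : |y| ≤ φ.maxRat) :
    (roundDown φ x).toRat ≤ (roundDown φ y).toRat :=
  toRat_le_roundDown hy _ (le_trans (toRat_roundDown_le hx) hxy)

/-- E3: round-up is monotone in range. [folklore] -/
theorem toRat_roundUp_mono {x y : ℚ} (hxy : x ≤ y) (hx : |x| ≤ φ.maxRat) (hy : |y| ≤ φ.maxRat) :
    (roundUp φ x).toRat ≤ (roundUp φ y).toRat :=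
  roundUp_le_toRat hx _ (le_trans hxy (le_toRat_roundUp hy))

/-- Sign symmetry: `roundNE` is odd as a map to values (`fl(-x) = -fl(x)`). [folklore] -/
theorem toRat_roundNE_neg (x : ℚ) : (roundNE φ (-x)).toRat = -(roundNE φ x).toRat := by
  rcases lt_trichotomy x 0 with h | h | h
  · rw [toRat_roundNE, toRat_roundNE, abs_neg, if_neg (by linarith), if_pos h]; ring
  · subst h; rw [neg_zero, toRat_roundNE_zero, neg_zero]
  · rw [toRat_roundNE, toRat_roundNE, abs_neg, if_pos (by linarith), if_neg (not_lt.mpr h.le)]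
    ring

end MiniFloat

end Literature.ComputerArithmetic.FloatingPoint
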